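import Literature.AnabelianGeometry.SemiGraphs.TemperedFixedLocusBaseImages
import Literature.AnabelianGeometry.SemiGraphs.NestedConnectedRay
import Mathlib.Combinatorics.SimpleGraph.Paths
import HarnessLib

/-!
# [SemiAnbd] Thm 3.7 (iii) beyond finite `𝔾`: horizontal escape of a compact subgroup runs along a RAY of `𝔾`

Mochizuki, *Semi-graphs of anabelioids*, Publ. RIMS **42** (2006), §3, Theorem 3.7 (iii), manuscript
p. 41 ("Since the semi-graphs `𝔾_j` are all finite …") [cite: MochizukiSemiAnbd2006, Thm 3.7(iii) p.41].

PROOF-ONLY (cell abc-iut, layer L3, GAP row G-t6g3-2b, sub-row G2·R1 «horizontal escape needs a ray»;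
seat abc-iut-w6-d066; no definition, no new named fact).  ASSEMBLY of abc-iut-w4-d080's base-image facts
(`TemperedFixedLocusBaseImages.lean`: the base images `B j ⊆ Vert 𝔾` of the `C`-fixed loci of the trees of
a level data `D` are nonempty for compact `C`, nested, and joined through themselves) with abc-iut-w5-d189's
generic ends piece (`NestedConnectedRay.lean`, GEN-ENDS (a)):

* `SemiGraph.reflTransGen_joins_of_isPath` — a PATH of the barycentric subdivision between two
  vertex-points all of whose vertex-points lie in `S` is a chain of vertices of `S` consecutively joined by
  edges (`SemiGraph.Joins`) — the conversion between the two connectivity currencies;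
* `VerticialLevelData.exists_ray_of_horizontalEscape` — if the base images of a compact `C` have empty
  intersection («horizontal escape», the right branch of `persistent_or_escape`) along a tower with a
  monotone cofinal sequence of levels, then `𝔾` has a RAY — an injective sequence of vertices consecutively
  joined by edges — with a tail inside every `B j`: the escape runs to an END of `𝔾` (so it needs an
  infinite, indeed not rayless, `𝔾`; cf. the cell's countermodel `𝒢_θ`, where the ray is the base ray).

With `compactInVerticialAt_or_horizontalEscape` (`TemperedCompactInVerticialAtOfPersistentLocFin.lean`)
this gives, at a locally finite countable `𝒢`: Thm 3.7 (iii) AT `𝒢`, or a nontrivial compact subgroup fixed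
along an end of `𝔾`.  Nothing here bears on [IUTchIII] Cor. 3.12.
-/

namespace Literature.AnabelianGeometry.SemiGraphs

namespace SemiGraph

universe u

variable {G : SemiGraph.{u}}

/-- **A subdivision path with vertex-points in `S` is a chain of `S`-vertices consecutively joined by edges.**
Along a path `u – c₀ – e – c₁ – w₁ – …` of the barycentric subdivision the branch-points `c₀ ≠ c₁` are the
two branches of `e`, abutting to `u` and `w₁`: `e` joins `u` to `w₁` (`SemiGraph.Joins`); induct.
[cite: MochizukiSemiAnbd2006, §1 pp.11-12] -/
theorem reflTransGen_joins_of_isPath (S : Set G.Vertex) :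
    ∀ (n : ℕ) {u x : G.Vertex} (p : G.subdivision.Walk (Sum.inl u) (Sum.inl x)),
      p.length = n → p.IsPath → (∀ w : G.Vertex, Sum.inl w ∈ p.support → w ∈ S) →
      Relation.ReflTransGen (fun a b => b ∈ S ∧ ∃ e, G.Joins e a b) u x := by
  intro n
  induction n using Nat.strong_induction_on with
  | _ n ih =>
  intro u x p hlen hp hS
  cases p with
  | nil => exact Relation.ReflTransGen.refl
  | cons h₁ p₁ =>
  rename_i n₁
  obtain ⟨c₀, hc₀u, rfl⟩ := (G.subdivision_adj_inl_iff u n₁).mp h₁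
  have hp₁ : p₁.IsPath ∧ Sum.inl u ∉ p₁.support := (SimpleGraph.Walk.cons_isPath_iff _ _).mp hp
  cases p₁ with
  | cons h₂ p₂ =>
  rename_i n₂
  rcases (G.subdivision_adj_branch_iff c₀ n₂).mp h₂ with rfl | ⟨v, hv, rfl⟩
  swap
  · exfalso
    have hvu : v = u := Option.some_injective _ (hv.symm.trans hc₀u)
    subst hvu
    exact hp₁.2 (by simp)
  have hp₂ : p₂.IsPath ∧ Sum.inr (Sum.inr c₀) ∉ p₂.support :=
    (SimpleGraph.Walk.cons_isPath_iff _ _).mp hp₁.1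
  cases p₂ with
  | cons h₃ p₃ =>
  rename_i n₃
  obtain ⟨c₁, hc₁e, rfl⟩ := (G.subdivision_adj_edge_iff (G.edgeOf c₀) n₃).mp h₃
  have hc₀₁ : c₀ ≠ c₁ := by
    rintro rfl
    exact hp₂.2 (by simp)
  have hp₃ : p₃.IsPath ∧ Sum.inr (Sum.inl (G.edgeOf c₀)) ∉ p₃.support :=
    (SimpleGraph.Walk.cons_isPath_iff _ _).mp hp₂.1
  cases p₃ with
  | cons h₄ p₄ =>
  rename_i n₄
  rcases (G.subdivision_adj_branch_iff c₁ n₄).mp h₄ with rfl | ⟨w₁, hw₁, rfl⟩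
  · exfalso
    refine hp₃.2 ?_
    rw [SimpleGraph.Walk.support_cons]
    refine List.mem_cons_of_mem _ ?_
    rw [← hc₁e]
    exact SimpleGraph.Walk.start_mem_support _
  have hp₄ : p₄.IsPath := ((SimpleGraph.Walk.cons_isPath_iff _ _).mp hp₃.1).1
  have hsupp : ∀ z, z ∈ p₄.support →
      z ∈ (SimpleGraph.Walk.cons h₁ (SimpleGraph.Walk.cons h₂ (SimpleGraph.Walk.cons h₃
        (SimpleGraph.Walk.cons h₄ p₄)))).support := by
    intro z hz
    simp only [SimpleGraph.Walk.support_cons, List.mem_cons]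
    exact Or.inr (Or.inr (Or.inr (Or.inr hz)))
  have hw₁S : w₁ ∈ S := hS w₁ (hsupp _ (SimpleGraph.Walk.start_mem_support _))
  have hjoin : G.Joins (G.edgeOf c₀) u w₁ := ⟨c₀, c₁, hc₀₁, rfl, hc₁e, hc₀u, hw₁⟩
  have hlen₄ : p₄.length = n - 4 := by
    simp only [SimpleGraph.Walk.length_cons] at hlen
    omega
  have hlt : n - 4 < n := by
    simp only [SimpleGraph.Walk.length_cons] at hlen
    omega
  have htail := ih (n - 4) hlt p₄ hlen₄ hp₄ (fun w hw => hS w (hsupp _ hw))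
  exact Relation.ReflTransGen.head ⟨hw₁S, _, hjoin⟩ htail

end SemiGraph

namespace ProfiniteSemiGraph

namespace VerticialLevelData

open CategoryTheory Topology

universe v u

variable {𝒢 : ProfiniteSemiGraph.{u}} {c : TemperedPiChart 𝒢} (D : VerticialLevelData.{v} 𝒢 c)

/-- **Horizontal escape runs along a ray of `𝔾`** ([SemiAnbd] Thm 3.7 (iii) p. 41, beyond finite `𝔾`):
let `C` be a compact subgroup of `π₁^temp(𝒢)` whose base images `B j` (vertices of `𝔾` under `C`-fixed tree
vertices of `𝒢_{∞,j}`) have EMPTY intersection, along a tower with a monotone cofinal sequence of levels.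
Then there is an injective sequence of vertices of `𝔾`, consecutively joined by edges, with a tail inside
every `B j` — abc-iut-w5-d189's `SemiGraph.exists_ray_of_nested_connected_directed` fed with
abc-iut-w4-d080's `baseFixedImage_nonempty` / `_antitone` / `_joined` (the subdivision walk made a path,
`Walk.bypass`, then a `Joins`-chain, `SemiGraph.reflTransGen_joins_of_isPath`).
[cite: MochizukiSemiAnbd2006, Thm 3.7(iii) p.41] -/
theorem exists_ray_of_horizontalEscape (C : Subgroup c.G) (hC : IsCompact (C : Set c.G))
    (s : ℕ → D.J) (hs : Monotone s) (hcof : ∀ j, ∃ n, j ≤ s n)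
    (hesc : ∀ v : 𝒢.graph.Vertex, ∃ j, v ∉ (D.proj j).vertexMap ''
      {x : (D.tree j).Vertex | ∀ g ∈ C, (D.act j g).hom.vertexMap x = x}) :
    ∃ r : ℕ → 𝒢.graph.Vertex, Function.Injective r ∧ (∀ k, ∃ e, 𝒢.graph.Joins e (r k) (r (k + 1))) ∧
      ∀ j, ∃ K, ∀ k, K ≤ k → r k ∈ (D.proj j).vertexMap ''
        {x : (D.tree j).Vertex | ∀ g ∈ C, (D.act j g).hom.vertexMap x = x} := by
  classical
  refine SemiGraph.exists_ray_of_nested_connected_directed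
    (fun j => (D.proj j).vertexMap '' {x : (D.tree j).Vertex | ∀ g ∈ C, (D.act j g).hom.vertexMap x = x})
    (fun i j h => D.baseFixedImage_antitone C h) (fun j => D.baseFixedImage_nonempty C hC j)
    (fun j x hx y hy => ?_) hesc s hs hcof
  -- connectivity through `B j`: subdivision walk ↦ path ↦ `Joins`-chain
  obtain ⟨p, hp⟩ := D.baseFixedImage_joined C j hx hy
  exact SemiGraph.reflTransGen_joins_of_isPath _ _ p.bypass rfl (p.bypass_isPath)
    (fun w hw => hp w (p.support_bypass_subset_support hw))

end VerticialLevelData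

end ProfiniteSemiGraph

end Literature.AnabelianGeometry.SemiGraphs
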